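import Summits.CriticalPhenomena.CardyFormulaZ2.Theorems.CardyUniqueLimitCardyRigiditySlitDuality2
import Summits.CriticalPhenomena.CardyFormulaZ2.Theorems.CardyUniqueLimitCardyRigiditySlitDualityWinding
import HarnessLib

/-!
# Slit duality, III: a slit crossing excludes a dual slit crossing (the Jordan half)

Crux `Summit.CriticalPhenomena.CardyFormulaZ2.Theses.CardyUniqueLimit.CardyRigidity`
(stmt-CriticalPhenomena-0746), line `crossing_martingale`, stub `stub_slitObservableApprox`
(THE HEART), piece (P-approx) "exact slit duality", disjointness half
`slitCrossing ∩ dualSlitCrossing = ∅` (vocabulary `…SlitDuality.lean`, covering half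
`…SlitDuality2.lean`, winding toolkit `…SlitDualityWinding.lean`).

The proof is the discrete Jordan-curve argument of `PlanarDuality.lean` by winding numbers
(`walkWinding`, Kesten 1982, §2.2) for the CLOSED lattice walk `J` made of the slit crossing `P`
(from `x ∈ X₁` to `y ∈ X₂ ∪ leftBank`), the followed edges of the prefix from `y` back towards the
start vertex `a` (if `y` is on the left bank), and a wired boundary walk `q` from there back to
`x`.  Every edge of `J` is open in the completed frozen configuration, so the dual chain never
crosses `J` and the winding of `J` is constant along it (`walkWinding_faceNbr_eq`); it vanishes
on the right bank (the right faces are reached from the non-inner outer face at `e_a` across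
crossed explored edges, none in `J`), on faces with a corner on `B` and on far faces — all are
joined to non-inner faces, which ESCAPE to infinity across non-edges of `Ω_δ` (the hypothesis
`hesc`, the face form of hole-freeness of a Jordan discretisation) —, while it jumps by `±1` across
the unexplored gap edge of the dual source, used exactly once by `J` (`walkWinding_faceNbr_ne`).

Hypotheses (geometry only): the escape property; gap and far edges are sides of at most one inner
face; far edges are wired; for every `x ∈ X₁` and `y ∈ {a} ∪ X₂` a walk of wired edges of `Ω_δ`
from `y` to `x` using every gap edge exactly once and no far edge.  (The escape property is
necessary: a free "filament handle" of `Ω_δ` outside the inner faces defeats the dichotomy.)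
-/

noncomputable section

open MeasureTheory Set
open Literature.Probability Literature.Probability.LatticeModels Literature.Probability.Percolation
open Literature.Probability.LatticeModels.DiscreteDobrushin
open Summit.CriticalPhenomena.CardyFormulaZ2.Cruxes.ParafermionToSLESixFamilies.CaratheodoryNetSlitUniformity
  (revealedFreeEdges freeze)

namespace Summit.CriticalPhenomena.CardyFormulaZ2.Cruxes.CardyRigidity.CrossingMartingale

namespace EventIdentity

section Jordan

variable {D : DiscreteDobrushin}

/-! ### Faces around the exploration -/

variable {x : Site 2} {hD : D.IsZdAdmissible} {ω₀ : BondConfig (Site 2)} {n : ℕ}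

/-- **The followed edges as a walk**: the left vertex of the `i`-th explored corner is joined to
the start vertex by a lattice walk along explored edges `j < i` open in the completed
configuration. [cite: Smirnov2001, §2] -/
theorem exists_walk_followed (hD : D.IsZdAdmissible) (ω₀ : BondConfig (Site 2)) (i : ℕ) :
    ∃ R : (zdGraph 2).Walk (startCorner hD).1 (cornerOrbit (D.bcBondConfig ω₀) (startCorner hD) i).1,
      ∀ e ∈ R.edges, ∃ j < i, exploredEdge hD ω₀ j = e ∧ e ∈ D.bcBondConfig ω₀ := by
  induction i with
  | zero =>
    rw [cornerOrbit_zero]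
    exact ⟨SimpleGraph.Walk.nil, fun e he ↦ absurd he (by simp)⟩
  | succ i ih =>
    obtain ⟨R, hR⟩ := ih
    rw [cornerOrbit_succ]
    by_cases h : cTgt (cornerOrbit (D.bcBondConfig ω₀) (startCorner hD) i) ∈ D.bcBondConfig ω₀
    · rw [nextCorner_of_mem h]
      have hadj : (zdGraph 2).Adj (cornerOrbit (D.bcBondConfig ω₀) (startCorner hD) i).1
          ((cornerOrbit (D.bcBondConfig ω₀) (startCorner hD) i).1 +
            cornerUnit ((cornerOrbit (D.bcBondConfig ω₀) (startCorner hD) i).2 + 1)) :=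
        (SimpleGraph.mem_edgeSet _).1 (cTgt_mem_edgeSet _)
      refine ⟨R.concat hadj, fun e he ↦ ?_⟩
      rw [SimpleGraph.Walk.edges_concat, List.concat_eq_append, List.mem_append, List.mem_singleton] at he
      rcases he with he | rfl
      · obtain ⟨j, hj, hje, hjo⟩ := hR e he
        exact ⟨j, Nat.lt_succ_of_lt hj, hje, hjo⟩
      · exact ⟨i, Nat.lt_succ_self i, rfl, h⟩
    · rw [nextCorner_of_not_mem h]
      refine ⟨R, fun e he ↦ ?_⟩
      obtain ⟨j, hj, hje, hjo⟩ := hR e he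
      exact ⟨j, Nat.lt_succ_of_lt hj, hje, hjo⟩

/-- On explored edges `i < min n N` the completed frozen configuration agrees with the completed
configuration of `ω₀`. [cite: DuminilCopinSmirnov2012Clay, §6.2] -/
theorem exploredEdge_mem_freeze_iff (ω : BondConfig (Site 2)) {i : ℕ} (hi : i < min n (exitTime hD ω₀)) :
    exploredEdge hD ω₀ i ∈ D.bcBondConfig (freeze hD ω₀ n ω) ↔ exploredEdge hD ω₀ i ∈ D.bcBondConfig ω₀ :=
  mem_explorationCylinder_iff_bc.1 (freeze_mem_explorationCylinder ω₀ n ω) i hi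

/-- **The right bank does not wind**: a closed lattice walk all of whose edges are open in the
completed frozen configuration winds equally around all faces of the right bank, namely as around
the outer face at `e_a`. [cite: Smirnov2001, §2] -/
theorem walkWinding_rightBank_eq (p : (zdGraph 2).Walk x x) {ω : BondConfig (Site 2)}
    (hp : ∀ e ∈ p.edges, e ∈ D.bcBondConfig (freeze hD ω₀ n ω)) {i : ℕ} (hi : i ≤ min n (exitTime hD ω₀)) :
    walkWinding p (cFace (cornerOrbit (D.bcBondConfig ω₀) (startCorner hD) i)) =
      walkWinding p (faceAt (startCorner hD).1 ((startCorner hD).2 + 3)) := by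
  induction i with
  | zero =>
    obtain ⟨-, hsrc, hnbr, -⟩ := cFace_faceSide (startCorner hD)
    rw [cornerOrbit_zero, ← hnbr, walkWinding_faceNbr_eq]
    rw [hsrc]
    exact fun he ↦ cSrc_start_not_mem hD (isStartCorner_startCorner hD) (hp _ he)
  | succ i ih =>
    have hi' : i < min n (exitTime hD ω₀) := Nat.lt_of_succ_le hi
    rw [← ih hi'.le, cornerOrbit_succ]
    set c := cornerOrbit (D.bcBondConfig ω₀) (startCorner hD) i with hc
    by_cases h : cTgt c ∈ D.bcBondConfig ω₀
    · rw [cFace_nextCorner_of_mem h]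
    · rw [cFace_nextCorner_of_not_mem h]
      obtain ⟨-, -, -, htgt, hnbr⟩ := cFace_faceSide c
      rw [← hnbr, walkWinding_faceNbr_eq]
      rw [htgt]
      exact fun he ↦ h ((exploredEdge_mem_freeze_iff ω hi').1 (hp _ he))

/-- **Faces with a corner on `B` do not wind** (all faces around a `B`-vertex have the same
winding number, the edges at it being closed, and one of them is not inner). [cite: Smirnov2001, §2] -/
theorem walkWinding_eq_zero_of_corner_mem_zdArcB
    (hesc : ∀ g : Site 2, ¬ D.IsInnerFace g → ∀ M : ℤ, ∃ g' : Site 2, M ≤ g' 1 ∧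
      Relation.ReflTransGen (fun f f' : Site 2 ↦ ∃ j : Fin 4, faceNbr f j = f' ∧
        faceSide f j ∉ (discreteDomainGraph D.Ω D.δ).edgeSet) g g')
    (p : (zdGraph 2).Walk x x) {ω : BondConfig (Site 2)}
    (hp : ∀ e ∈ p.edges, e ∈ D.bcBondConfig (freeze hD ω₀ n ω)) {f : Site 2} {j : Fin 4}
    (hb : f + cornerOff j ∈ D.zdArcB) : walkWinding p f = 0 := by
  set b := f + cornerOff j with hbdef
  have hpΩ : ∀ e ∈ p.edges, e ∈ (discreteDomainGraph D.Ω D.δ).edgeSet := fun e he ↦ (hp e he).1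
  -- all faces around `b` have the same winding number
  have h3 : ∀ k : Fin 4, walkWinding p (faceAt b (k + 3)) = walkWinding p (faceAt b k) := by
    intro k
    obtain ⟨-, hsrc, hnbr, -⟩ := cFace_faceSide (b, k)
    simp only [cFace] at hsrc hnbr
    rw [← hnbr, walkWinding_faceNbr_eq]
    rw [hsrc]
    exact fun he ↦ not_mem_bcBondConfig_of_mem_zdArcB hD (Sym2.mem_mk_left _ _) hb (hp _ he)
  have hall : ∀ k k' : Fin 4, walkWinding p (faceAt b k') = walkWinding p (faceAt b k) := by
    intro k k'
    have : k' = k ∨ k' = k + 3 ∨ k' = k + 3 + 3 ∨ k' = k + 3 + 3 + 3 := by revert k k'; decide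
    rcases this with rfl | rfl | rfl | rfl
    · rfl
    · rw [h3]
    · rw [h3, h3]
    · rw [h3, h3, h3]
  -- one of them is not inner
  have hex : ∃ k, ¬ D.IsInnerFace (faceAt b k) := by
    rcases D.zdArcB_subset_zdBoundary hb with hm | ⟨y, hby⟩
    · obtain ⟨-, y, hy, hny⟩ := (mem_meshBoundary_iff).1 hm
      obtain ⟨k, rfl⟩ := exists_eq_add_cornerUnit hy
      exact ⟨k, fun hf ↦ hny (adj_of_isInnerFace_faceAt hf (Or.inl rfl))⟩
    · obtain ⟨f', hf', hbf', -⟩ := hby.2.2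
      obtain ⟨k, rfl⟩ := exists_faceAt_of_isCorner hbf'
      exact ⟨k, hf'⟩
  obtain ⟨k, hk⟩ := hex
  have hf : f = faceAt b j := by rw [hbdef, faceAt_add_cornerOff]
  rw [hf, hall k j]
  exact walkWinding_eq_zero_of_not_isInnerFace hesc p hpΩ hk

/-! ### The disjointness half of the dichotomy -/

/-- **A slit crossing excludes a dual slit crossing.**  For admissible data, a prefix (`ω₀`, `n`),
site sets `X₁, X₂` and designated edge sets `𝒢` (gap), `ℱ` (far) such that: every non-inner face
escapes to faces of arbitrary height across non-edges of `Ω_δ`; a gap or far edge is a side of at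
most one inner face; far edges are wired; and for every `x ∈ X₁`, `y ∈ {a} ∪ X₂` some walk of wired
edges of `Ω_δ` from `y` to `x` uses every gap edge exactly once and no far edge — no configuration
has both a slit crossing `X₁ ↔ X₂ ∪ leftBank` and a dual slit crossing.
[cite: BollobasRiordan2006, Ch. 3, Lemma 1] -/
theorem not_mem_dualSlitCrossing_of_mem_slitCrossing {X₁ X₂ : Set (Site 2)} {𝒢 ℱ : Set (Sym2 (Site 2))}
    (hesc : ∀ g : Site 2, ¬ D.IsInnerFace g → ∀ M : ℤ, ∃ g' : Site 2, M ≤ g' 1 ∧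
      Relation.ReflTransGen (fun f f' : Site 2 ↦ ∃ j : Fin 4, faceNbr f j = f' ∧
        faceSide f j ∉ (discreteDomainGraph D.Ω D.δ).edgeSet) g g')
    (h𝒢 : ∀ f f' : Site 2, ∀ j j' : Fin 4, D.IsInnerFace f → D.IsInnerFace f' → faceSide f j ∈ 𝒢 →
      faceSide f j = faceSide f' j' → f = f')
    (hℱ : ∀ f f' : Site 2, ∀ j j' : Fin 4, D.IsInnerFace f → D.IsInnerFace f' → faceSide f j ∈ ℱ →
      faceSide f j = faceSide f' j' → f = f')
    (hℱA : ∀ e ∈ ℱ, ∀ v ∈ e, v ∈ D.zdArcA)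
    (hq : ∀ x ∈ X₁, ∀ y ∈ insert (startCorner hD).1 X₂, ∃ q : (zdGraph 2).Walk y x,
      (∀ e ∈ q.edges, e ∈ (discreteDomainGraph D.Ω D.δ).edgeSet ∧ ∀ v ∈ e, v ∈ D.zdArcA) ∧
      (∀ e ∈ 𝒢, q.edges.count e = 1) ∧ ∀ e ∈ ℱ, e ∉ q.edges)
    {ω : BondConfig (Site 2)} (hω : ω ∈ slitCrossing hD X₁ X₂ ω₀ n) : ω ∉ dualSlitCrossing hD 𝒢 ℱ ω₀ n := by
  classical
  rintro ⟨f₀, ⟨hf₀, j₀, hj₀𝒢, hj₀un⟩, f₁, hf₁, ⟨Q⟩⟩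
  obtain ⟨x, hx, y, hy, ⟨P⟩⟩ := hω
  set β := D.bcBondConfig (freeze hD ω₀ n ω) with hβ
  set β₀ := D.bcBondConfig ω₀ with hβ₀
  -- the slit path as a lattice walk
  have hle : slitGraph hD ω₀ n ω ≤ zdGraph 2 := fun a b hab ↦
    meshGraph_le_zdGraph _ _ (discreteDomainGraph_le_meshGraph _ _
      ((SimpleGraph.mem_edgeSet _).1 (slitGraph_adj.1 hab).1.1))
  set P' : (zdGraph 2).Walk x y := P.mapLe hle with hP'
  have hP'e : ∀ e ∈ P'.edges, D.IsFreeEdge e ∧ e ∈ ω ∧ e ∉ revealedFreeEdges hD ω₀ n := by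
    intro e he
    rw [hP', SimpleGraph.Walk.edges_mapLe_eq_edges] at he
    have := P.edges_subset_edgeSet he
    rw [slitGraph, SimpleGraph.edgeSet_fromEdgeSet] at this
    exact this.1
  -- back from `y` to `{a} ∪ X₂` along followed edges
  obtain ⟨y', hy', R, hR⟩ : ∃ y' ∈ insert (startCorner hD).1 X₂, ∃ R : (zdGraph 2).Walk y y',
      ∀ e ∈ R.edges, ∃ j < min n (exitTime hD ω₀), exploredEdge hD ω₀ j = e ∧ e ∈ β₀ := by
    rcases hy with hy | ⟨i, hi, rfl⟩
    · exact ⟨y, mem_insert_of_mem _ hy, SimpleGraph.Walk.nil, by simp⟩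
    · obtain ⟨R, hR⟩ := exists_walk_followed hD ω₀ i
      refine ⟨_, mem_insert _ _, R.reverse, fun e he ↦ ?_⟩
      rw [SimpleGraph.Walk.edges_reverse, List.mem_reverse] at he
      obtain ⟨j, hj, hje⟩ := hR e he
      exact ⟨j, lt_of_lt_of_le hj hi, hje⟩
  obtain ⟨q, hqA, hq𝒢, hqℱ⟩ := hq x hx y' hy'
  -- the closed walk `J`
  set J : (zdGraph 2).Walk x x := (P'.append R).append q with hJ
  have hJedges : J.edges = P'.edges ++ R.edges ++ q.edges := by
    rw [hJ, SimpleGraph.Walk.edges_append, SimpleGraph.Walk.edges_append]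
  have hRβ : ∀ e ∈ R.edges, e ∈ β := fun e he ↦ by
    obtain ⟨j, hj, rfl, hjo⟩ := hR e he
    exact (exploredEdge_mem_freeze_iff ω hj).2 hjo
  have hJβ : ∀ e ∈ J.edges, e ∈ β := by
    intro e he
    rw [hJedges, List.mem_append, List.mem_append] at he
    rcases he with (he | he) | he
    · obtain ⟨hf, hω, hR⟩ := hP'e e he
      refine (mem_bcBondConfig_iff_of_isFreeEdge hf _).2 ?_
      simp only [freeze, mem_union, mem_sdiff, mem_inter_iff]
      exact Or.inl ⟨hω, hR⟩
    · exact hRβ e he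
    · exact mem_bcBondConfig_of_arcA (hqA e he).1 (hqA e he).2
  have hJΩ : ∀ e ∈ J.edges, e ∈ (discreteDomainGraph D.Ω D.δ).edgeSet := fun e he ↦ (hJβ e he).1
  -- (i) the winding of `J` is constant along the dual chain
  have hQ : ∀ {g g' : Site 2}, (dualSlitGraph hD ω₀ n ω).Walk g g' → walkWinding J g = walkWinding J g' := by
    intro g g' W
    induction W with
    | nil => rfl
    | cons hadj _ ih =>
      rw [← ih]
      rcases (dualSlitGraph_adj.1 hadj).2 with ⟨-, -, j, rfl, hj⟩ | ⟨-, -, j, rfl, hj⟩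
      · exact (walkWinding_faceNbr_eq J fun he ↦ hj (hJβ _ he)).symm
      · exact walkWinding_faceNbr_eq J fun he ↦ hj (hJβ _ he)
  -- (ii) the dual target does not wind
  have h₁ : walkWinding J f₁ = 0 := by
    obtain ⟨hf₁in, hcase⟩ := hf₁
    have hout : walkWinding J (faceAt (startCorner hD).1 ((startCorner hD).2 + 3)) = 0 :=
      walkWinding_eq_zero_of_not_isInnerFace hesc J hJΩ (isStartCorner_startCorner hD).isOutEdge.2
    rcases hcase with ⟨i, hi, rfl⟩ | ⟨j, hjℱ⟩ | ⟨j, hjB⟩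
    · rw [walkWinding_rightBank_eq J hJβ hi, hout]
    · by_cases hmem : faceSide f₁ j ∈ J.edges
      · -- a far edge of `J` is a followed explored edge: `f₁` is on the right bank
        rw [hJedges, List.mem_append, List.mem_append] at hmem
        rcases hmem with (he | he) | he
        · exact ((hP'e _ he).1.2.2 (hℱA _ hjℱ)).elim
        · obtain ⟨i, hi, hie, hio⟩ := hR _ he
          set c := cornerOrbit (D.bcBondConfig ω₀) (startCorner hD) i with hc
          have hcin : D.IsInnerFace (cFace c) :=
            isInnerFace_of_lt_exitTime hD ω₀ (lt_of_lt_of_le hi (min_le_right _ _))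
          obtain ⟨-, -, -, htgt, -⟩ := cFace_faceSide c
          have hf₁c : f₁ = cFace c := hℱ f₁ (cFace c) j (c.2 + 3) hf₁in hcin hjℱ (by rw [htgt, ← hie, hc]; rfl)
          rw [hf₁c, hc, walkWinding_rightBank_eq J hJβ hi.le, hout]
        · exact (hqℱ _ hjℱ he).elim
      · have hnb : ¬ D.IsInnerFace (faceNbr f₁ j) := fun hn ↦ faceNbr_ne f₁ j
          (hℱ _ _ (j + 2) j hn hf₁in (by rwa [faceSide_faceNbr]) (faceSide_faceNbr f₁ j))
        rw [← walkWinding_faceNbr_eq J hmem]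
        exact walkWinding_eq_zero_of_not_isInnerFace hesc J hJΩ hnb
    · exact walkWinding_eq_zero_of_corner_mem_zdArcB hesc J hJβ hjB
  -- (iii) the dual source winds: its gap edge is used exactly once by `J`
  have hcount : J.edges.count (faceSide f₀ j₀) = 1 := by
    have h𝒢q : faceSide f₀ j₀ ∈ q.edges := List.count_pos_iff.1 (by rw [hq𝒢 _ hj₀𝒢]; exact Nat.one_pos)
    have hP0 : P'.edges.count (faceSide f₀ j₀) = 0 :=
      List.count_eq_zero.2 fun he ↦ (hP'e _ he).1.2.2 (hqA _ h𝒢q).2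
    have hR0 : R.edges.count (faceSide f₀ j₀) = 0 := List.count_eq_zero.2 fun he ↦ by
      obtain ⟨i, hi, hie, -⟩ := hR _ he
      exact hj₀un i hi hie
    rw [hJedges, List.count_append, List.count_append, hP0, hR0, hq𝒢 _ hj₀𝒢]
  have hnb₀ : ¬ D.IsInnerFace (faceNbr f₀ j₀) := fun hn ↦ faceNbr_ne f₀ j₀
    (h𝒢 _ _ (j₀ + 2) j₀ hn hf₀ (by rwa [faceSide_faceNbr]) (faceSide_faceNbr f₀ j₀))
  have h₀ : walkWinding J f₀ ≠ 0 := by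
    rw [← walkWinding_eq_zero_of_not_isInnerFace hesc J hJΩ hnb₀]
    exact (walkWinding_faceNbr_ne J hcount).symm
  exact h₀ ((hQ Q).trans h₁)

/-- **The disjointness half of the exact slit duality.** [cite: BollobasRiordan2006, Ch. 3, Lemma 1] -/
theorem disjoint_slitCrossing_dualSlitCrossing {X₁ X₂ : Set (Site 2)} {𝒢 ℱ : Set (Sym2 (Site 2))}
    (hesc : ∀ g : Site 2, ¬ D.IsInnerFace g → ∀ M : ℤ, ∃ g' : Site 2, M ≤ g' 1 ∧
      Relation.ReflTransGen (fun f f' : Site 2 ↦ ∃ j : Fin 4, faceNbr f j = f' ∧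
        faceSide f j ∉ (discreteDomainGraph D.Ω D.δ).edgeSet) g g')
    (h𝒢 : ∀ f f' : Site 2, ∀ j j' : Fin 4, D.IsInnerFace f → D.IsInnerFace f' → faceSide f j ∈ 𝒢 →
      faceSide f j = faceSide f' j' → f = f')
    (hℱ : ∀ f f' : Site 2, ∀ j j' : Fin 4, D.IsInnerFace f → D.IsInnerFace f' → faceSide f j ∈ ℱ →
      faceSide f j = faceSide f' j' → f = f')
    (hℱA : ∀ e ∈ ℱ, ∀ v ∈ e, v ∈ D.zdArcA)
    (hq : ∀ x ∈ X₁, ∀ y ∈ insert (startCorner hD).1 X₂, ∃ q : (zdGraph 2).Walk y x,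
      (∀ e ∈ q.edges, e ∈ (discreteDomainGraph D.Ω D.δ).edgeSet ∧ ∀ v ∈ e, v ∈ D.zdArcA) ∧
      (∀ e ∈ 𝒢, q.edges.count e = 1) ∧ ∀ e ∈ ℱ, e ∉ q.edges) :
    Disjoint (slitCrossing hD X₁ X₂ ω₀ n) (dualSlitCrossing hD 𝒢 ℱ ω₀ n) :=
  disjoint_left.2 fun _ hω ↦ not_mem_dualSlitCrossing_of_mem_slitCrossing hesc h𝒢 hℱ hℱA hq hω

/-! ### The exact slit duality -/

/-- **The exact slit duality** (both halves under the union of their hypotheses): for admissible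
data, a prefix (`ω₀`, `n`), site sets `X₁, X₂` and designated wired edge sets `𝒢` (gap), `ℱ` (far)
such that gap edges are sides of inner faces, no wired edge of `Ω_δ` is a side of two inner faces,
every wired boundary side lies inside `X₂`, inside `X₁`, in `𝒢` or in `ℱ`, non-inner faces
escape to infinity across non-edges of `Ω_δ`, and the wired boundary walks exist (from `a` to some
site of `X₁` without repeated edge through all gap edges and otherwise inside `X₂` or `X₁`; from
every `y ∈ {a} ∪ X₂` to every `x ∈ X₁` through each gap edge once and no far edge), EXACTLY ONE of
the slit crossing event `X₁ ↔ X₂ ∪ leftBank` and the dual slit crossing event holds at every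
configuration. [cite: BollobasRiordan2006, Ch. 3, Lemma 1] -/
theorem slitCrossing_union_eq_univ_and_disjoint {X₁ X₂ : Set (Site 2)} {𝒢 ℱ : Set (Sym2 (Site 2))}
    (h𝒢A : ∀ e ∈ 𝒢, ∀ x ∈ e, x ∈ D.zdArcA) (hℱA : ∀ e ∈ ℱ, ∀ v ∈ e, v ∈ D.zdArcA)
    (h𝒢in : ∀ e ∈ 𝒢, ∃ (f : Site 2) (j : Fin 4), D.IsInnerFace f ∧ faceSide f j = e)
    (hchord : ∀ f f' : Site 2, ∀ j j' : Fin 4, D.IsInnerFace f → D.IsInnerFace f' →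
      faceSide f j = faceSide f' j' → (∀ x ∈ faceSide f j, x ∈ D.zdArcA) → f = f')
    (hcover : ∀ (f : Site 2) (j : Fin 4), D.IsInnerFace f → ¬ D.IsInnerFace (faceNbr f j) →
      (∀ x ∈ faceSide f j, x ∈ D.zdArcA) → (∀ x ∈ faceSide f j, x ∈ X₂) ∨
        (∀ x ∈ faceSide f j, x ∈ X₁) ∨ faceSide f j ∈ 𝒢 ∨ faceSide f j ∈ ℱ)
    (hesc : ∀ g : Site 2, ¬ D.IsInnerFace g → ∀ M : ℤ, ∃ g' : Site 2, M ≤ g' 1 ∧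
      Relation.ReflTransGen (fun f f' : Site 2 ↦ ∃ j : Fin 4, faceNbr f j = f' ∧
        faceSide f j ∉ (discreteDomainGraph D.Ω D.δ).edgeSet) g g')
    (hq₁ : ∃ x ∈ X₁, ∃ q : (zdGraph 2).Walk (startCorner hD).1 x, q.edges.Nodup ∧
      (∀ e ∈ 𝒢, e ∈ q.edges) ∧ ∀ e ∈ q.edges, e ∈ 𝒢 ∨ (∀ x ∈ e, x ∈ X₂) ∨ (∀ x ∈ e, x ∈ X₁))
    (hq₂ : ∀ x ∈ X₁, ∀ y ∈ insert (startCorner hD).1 X₂, ∃ q : (zdGraph 2).Walk y x,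
      (∀ e ∈ q.edges, e ∈ (discreteDomainGraph D.Ω D.δ).edgeSet ∧ ∀ v ∈ e, v ∈ D.zdArcA) ∧
      (∀ e ∈ 𝒢, q.edges.count e = 1) ∧ ∀ e ∈ ℱ, e ∉ q.edges) :
    slitCrossing hD X₁ X₂ ω₀ n ∪ dualSlitCrossing hD 𝒢 ℱ ω₀ n = univ ∧
      Disjoint (slitCrossing hD X₁ X₂ ω₀ n) (dualSlitCrossing hD 𝒢 ℱ ω₀ n) :=
  ⟨slitCrossing_union_dualSlitCrossing h𝒢A h𝒢in hchord hcover hq₁,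
    disjoint_slitCrossing_dualSlitCrossing hesc
      (fun f f' j j' hf hf' hj h ↦ hchord f f' j j' hf hf' h (h𝒢A _ hj))
      (fun f f' j j' hf hf' hj h ↦ hchord f f' j j' hf hf' h (hℱA _ hj)) hℱA hq₂⟩

/-- **`P(slit crossing) + P(dual slit crossing) = 1`** for every probability measure on
configurations, under the hypotheses of the exact slit duality. [cite: BollobasRiordan2006, Ch. 3, Lemma 1] -/
theorem measureReal_slitCrossing_add_dualSlitCrossing {X₁ X₂ : Set (Site 2)} {𝒢 ℱ : Set (Sym2 (Site 2))}
    (μ : Measure (BondConfig (Site 2))) [IsProbabilityMeasure μ]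
    (h𝒢A : ∀ e ∈ 𝒢, ∀ x ∈ e, x ∈ D.zdArcA) (hℱA : ∀ e ∈ ℱ, ∀ v ∈ e, v ∈ D.zdArcA)
    (h𝒢in : ∀ e ∈ 𝒢, ∃ (f : Site 2) (j : Fin 4), D.IsInnerFace f ∧ faceSide f j = e)
    (hchord : ∀ f f' : Site 2, ∀ j j' : Fin 4, D.IsInnerFace f → D.IsInnerFace f' →
      faceSide f j = faceSide f' j' → (∀ x ∈ faceSide f j, x ∈ D.zdArcA) → f = f')
    (hcover : ∀ (f : Site 2) (j : Fin 4), D.IsInnerFace f → ¬ D.IsInnerFace (faceNbr f j) →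
      (∀ x ∈ faceSide f j, x ∈ D.zdArcA) → (∀ x ∈ faceSide f j, x ∈ X₂) ∨
        (∀ x ∈ faceSide f j, x ∈ X₁) ∨ faceSide f j ∈ 𝒢 ∨ faceSide f j ∈ ℱ)
    (hesc : ∀ g : Site 2, ¬ D.IsInnerFace g → ∀ M : ℤ, ∃ g' : Site 2, M ≤ g' 1 ∧
      Relation.ReflTransGen (fun f f' : Site 2 ↦ ∃ j : Fin 4, faceNbr f j = f' ∧
        faceSide f j ∉ (discreteDomainGraph D.Ω D.δ).edgeSet) g g')
    (hq₁ : ∃ x ∈ X₁, ∃ q : (zdGraph 2).Walk (startCorner hD).1 x, q.edges.Nodup ∧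
      (∀ e ∈ 𝒢, e ∈ q.edges) ∧ ∀ e ∈ q.edges, e ∈ 𝒢 ∨ (∀ x ∈ e, x ∈ X₂) ∨ (∀ x ∈ e, x ∈ X₁))
    (hq₂ : ∀ x ∈ X₁, ∀ y ∈ insert (startCorner hD).1 X₂, ∃ q : (zdGraph 2).Walk y x,
      (∀ e ∈ q.edges, e ∈ (discreteDomainGraph D.Ω D.δ).edgeSet ∧ ∀ v ∈ e, v ∈ D.zdArcA) ∧
      (∀ e ∈ 𝒢, q.edges.count e = 1) ∧ ∀ e ∈ ℱ, e ∉ q.edges) :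
    μ.real (slitCrossing hD X₁ X₂ ω₀ n) + μ.real (dualSlitCrossing hD 𝒢 ℱ ω₀ n) = 1 := by
  obtain ⟨hunion, hdisj⟩ := slitCrossing_union_eq_univ_and_disjoint (hD := hD) (ω₀ := ω₀) (n := n)
    h𝒢A hℱA h𝒢in hchord hcover hesc hq₁ hq₂
  rw [← measureReal_union hdisj (measurableSet_dualSlitCrossing 𝒢 ℱ ω₀ n), hunion, probReal_univ]

end Jordan

end EventIdentity

/-- **Registered form** (anchor `slitDuality_measureReal_slitCrossing_add_dualSlitCrossing` of stmt-CriticalPhenomena-0746):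
the exact slit duality in probability — `P(slit crossing) + P(dual slit crossing) = 1` for every probability measure on
configurations, for admissible data, a prefix (`ω₀`, `n`), site sets `X₁, X₂` and designated wired edge sets `𝒢` (gap), `ℱ`
(far) satisfying the geometric hypotheses (gap edges are wired sides of inner faces; far edges wired; no wired chord; wired
boundary sides lie inside `X₂`, inside `X₁`, in `𝒢` or in `ℱ`; non-inner faces escape across non-edges of `Ω_δ`; wired
boundary walks from `a` to `X₁` and from `{a} ∪ X₂` to `X₁` through the gap edges). [cite: BollobasRiordan2006, Ch. 3, Lemma 1] -/
theorem slitDuality_measureReal_slitCrossing_add_dualSlitCrossing : ∀ {D : Literature.Probability.LatticeModels.DiscreteDobrushin} (hD : D.IsZdAdmissible) (X₁ X₂ : Set (Literature.Probability.LatticeModels.Site 2)) (𝒢 ℱ : Set (Sym2 (Literature.Probability.LatticeModels.Site 2))) (ω₀ : Literature.Probability.Percolation.BondConfig (Literature.Probability.LatticeModels.Site 2)) (n : ℕ) (μ : MeasureTheory.Measure (Literature.Probability.Percolation.BondConfig (Literature.Probability.LatticeModels.Site 2))) [MeasureTheory.IsProbabilityMeasure μ], (∀ e ∈ 𝒢,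 ∀ x ∈ e, x ∈ D.zdArcA) → (∀ e ∈ ℱ, ∀ v ∈ e, v ∈ D.zdArcA) → (∀ e ∈ 𝒢, ∃ (f : Literature.Probability.LatticeModels.Site 2) (j : Fin 4), D.IsInnerFace f ∧ EventIdentity.faceSide f j = e) → (∀ f f' : Literature.Probability.LatticeModels.Site 2, ∀ j j' : Fin 4, D.IsInnerFace f → D.IsInnerFace f' → EventIdentity.faceSide f j = EventIdentity.faceSide f' j' → (∀ x ∈ EventIdentity.faceSide f j, x ∈ D.zdArcA) → f = f') → (∀ (f : Literature.Probability.LatticeModels.Site 2) (j : Fin 4), D.IsInnerFace f → ¬ D.IsInnerFace (EventIdentity.faceNbr f j) → (∀ x ∈ EventIdentity.faceSide f j, x ∈ D.zdArcA) → (∀ x ∈ EventIdentity.faceSide f j, x ∈ X₂) ∨ (∀ x ∈ EventIdentity.faceSide f j, x ∈ X₁) ∨ EventIdentity.faceSide f j ∈ 𝒢 ∨ EventIdentity.faceSide f j ∈ ℱ) → (∀ g : Literature.Probability.LatticeModels.Site 2, ¬ D.IsInnerFace g → ∀ M : ℤ, ∃ g' : Literature.Probability.LatticeModels.Site 2, M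 ≤ g' 1 ∧ Relation.ReflTransGen (fun f f' : Literature.Probability.LatticeModels.Site 2 ↦ ∃ j : Fin 4, EventIdentity.faceNbr f j = f' ∧ EventIdentity.faceSide f j ∉ (Literature.Probability.LatticeModels.discreteDomainGraph D.Ω D.δ).edgeSet) g g') → (∃ x ∈ X₁, ∃ q : (Literature.Probability.LatticeModels.zdGraph 2).Walk (Literature.Probability.LatticeModels.DiscreteDobrushin.startCorner hD).1 x, q.edges.Nodup ∧ (∀ e ∈ 𝒢, e ∈ q.edges) ∧ ∀ e ∈ q.edges, e ∈ 𝒢 ∨ (∀ x ∈ e, x ∈ X₂) ∨ (∀ x ∈ e, x ∈ X₁)) → (∀ x ∈ X₁, ∀ y ∈ insert (Literature.Probability.LatticeModels.DiscreteDobrushin.startCorner hD).1 X₂, ∃ q : (Literature.Probability.LatticeModels.zdGraph 2).Walk y x, (∀ e ∈ q.edges, e ∈ (Literature.Probability.LatticeModels.discreteDomainGraph D.Ω D.δ).edgeSet ∧ ∀ v ∈ e, v ∈ D.zdArcA) ∧ (∀ e ∈ 𝒢, q.edges.count e = 1) ∧ ∀ e ∈ ℱ, e ∉ q.edges) → μ.real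 (EventIdentity.slitCrossing hD X₁ X₂ ω₀ n) + μ.real (EventIdentity.dualSlitCrossing hD 𝒢 ℱ ω₀ n) = 1 :=
  fun hD X₁ X₂ 𝒢 ℱ ω₀ n μ _ h𝒢A hℱA h𝒢in hchord hcover hesc hq₁ hq₂ ↦
    EventIdentity.measureReal_slitCrossing_add_dualSlitCrossing (hD := hD) (X₁ := X₁) (X₂ := X₂) (𝒢 := 𝒢) (ℱ := ℱ)
      (ω₀ := ω₀) (n := n) μ h𝒢A hℱA h𝒢in hchord hcover hesc hq₁ hq₂

end Summit.CriticalPhenomena.CardyFormulaZ2.Cruxes.CardyRigidity.CrossingMartingale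

end
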